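import Literature.AlgebraicGeometry.Motives.HodgeStructureStableSubHodgeStructuresCanonicalBlocks
import Literature.AlgebraicGeometry.Motives.HodgeStructureLefschetzGroupPoints
import HarnessLib

/-!
# MILNE'S CENTRALIZER `C(H) = End_{E_φ}(V)` ALONG AN INTERNAL DIRECT SUM `V = ⊕_k W_k` OF SUB-HODGE STRUCTURES: every
# `c ∈ C(H)` preserves each block and restricts to `C(W_k)`; for Hom-orthogonal blocks (in particular for `E_φ`-STABLE blocks,
# and for the CANONICAL blocks = the minimal `E_φ`-stable sub-Hodge structures) restriction is an isomorphism of `ℚ`-algebras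
# WITH INVOLUTION `(C(H), †) ≃ₐ Π_k (C(W_k), †_k)`, and `dim C(H) = Σ_k dim C(W_k)` (Milne 1999 §1, p. 643: «Let
# `A = A₁ × ⋯ × A_s`. Then `C(A) ⊂ C(A₁) × ⋯ × C(A_s)`, with equality holding if and only if `Hom(Aᵢ, Aⱼ) = 0` for all
# `i ≠ j` … the involution it defines on `C(A)` is the restriction of the product of the involutions»; Prop. 1.1)

[topic AlgebraicGeometry/Motives]

Layer `Literature/AlgebraicGeometry/Motives`, lane `lit-hodgefound` (Track 2 foundations library; prover seat
`lit-hodgefound-p02`, generation 52, self-proposed row g52-#3). THEOREMS ONLY: no definition, no named fact (net debt `0`),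
no instance, no notation.  Joins, BY NAME (nothing restated): Milne's centralizer `C(H) = Subalgebra.centralizer ℚ E_φ` and its
`†`-stability (`Motives/HodgeStructureLefschetzGroupPoints`, p34 g18-#1: `Polarization.adjoint_mem_centralizer_endAlg`), the
projections `isInternalProj ∕ SubHodgeStructure.internalProjHom` of an internal direct sum of sub-Hodge structures
(`Motives/HodgeStructureExteriorPowerLefschetzPolarization`), extension by zero
(`SubHodgeStructure.exists_mem_endAlg_apply_eq_apply_eq_zero`, g51-#4), the adjoint of a restriction
(`Polarization.restrict_adjoint_eq_of_forall_coe_apply_eq`, g51-#1), and the canonical blocks (g51-#8∕#9: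
`Polarization.isInternal_minimal_stable`, `Polarization.finite_setOf_minimal_stable`, `Polarization.hom_eq_zero_of_minimal_stable_of_ne`).
The tree states Milne's `C(A) ⊂ Π C(Aᵢ)` ∕ Prop. 1.1 for EXTERNAL sums and powers (`Motives/HodgeStructureCentralizerDirectSum`,
`…CentralizerFiniteDirectSumPoints`, `…LefschetzGroupSimpleIsogenyFactors`: `H₁.prod H₂`, `HodgeStructure.pi`); here the blocks are
sub-Hodge structures of ONE `H` (an internal decomposition), which is the form in which the canonical blocks of g51∕g52 arise.

## The source, verbatim

J. S. Milne, *Lefschetz classes on abelian varieties*, Duke Math. J. 96 (1999) 639–675 [Milne1999LefschetzClasses] (held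
`paper:doi-10-1215-s0012-7094-99-09620-5`), §1 p. 643: "Let `C(A)` be the centralizer of `End⁰(A)` in `End(V(A))`. … `C(A)` is a
`k`-algebra stable under the involution `†` … Let `A = A₁ × ⋯ × A_s`. Then `C(A) ⊂ C(A₁) × ⋯ × C(A_s)`, with equality holding
if and only if `Hom(Aᵢ, Aⱼ) = 0` for all `i ≠ j`. When equality holds and `A` is polarized by a divisor of the form
`D = Σ pᵢ^* Dᵢ`, the involution it defines on `C(A)` is the restriction of the product of the involutions on the `C(Aᵢ)`
defined by the `Dᵢ`'s."; Prop. 1.1: "Any such isogeny induces an isomorphism `C(A₁) × ⋯ × C(A_s) → C(A)` of `k`-algebras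
with involution".  Also B. Moonen, *An introduction to Mumford–Tate groups* (2004) [Moonen2004MT], §4 Lemma 4.6 (block form of
the commutant of a product), and H. Lange, *Abelian Varieties over the Complex Numbers* [Lange2023AbelianVarietiesComplex], §2.4.4
proof of Cor. 2.4.26 (p. 124: extension by zero, «`End_ℚ(X) = ⊕_ν End_ℚ(X_ν^{n_ν})`»).

## Dictionary and what is proved (namespace `Literature.AlgebraicGeometry.Motives.HodgeStructure`)

`C(H) = Subalgebra.centralizer ℚ (H.endAlg : Set (Module.End ℚ V))`; for a sub-Hodge structure `W`,
`C(W) = Subalgebra.centralizer ℚ (W.toHodgeStructure.endAlg : Set (Module.End ℚ W.toSubmodule))`; `W : κ → SubHodgeStructure H`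
an internal direct sum (`DirectSum.IsInternal`), projections `π_k = isInternalProj`; "Hom-orthogonal" = `Hom_HS(W_k, W_l) = 0` for
`k ≠ l`; "`E_φ`-stable" = `∀ a ∈ E_φ, a W_k ⊆ W_k`; `†` = `Polarization.adjoint`, `†_k` that of `ψ|_{W_k}`.

* §1 (any internal sum) `isInternalProj_mem_endAlg'` (`π_k ∈ E_φ`), **`apply_mem_of_mem_centralizer_endAlg`** (`c W_k ⊆ W_k`),
  **`restrict_mem_centralizer_endAlg`** (`c|_{W_k} ∈ C(W_k)`), **`exists_algHom_pi_centralizer`** (the restriction map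
  `C(H) →ₐ[ℚ] Π_k C(W_k)` exists and is INJECTIVE — «`C(A) ⊂ C(A₁) × ⋯ × C(A_s)`»).
* §2 (Hom-orthogonal blocks) `hom_eq_zero_of_forall_stable` (`E_φ`-stable blocks are Hom-orthogonal),
  `sum_comp_mem_centralizer_endAlg_of_hom_orthogonal` (gluing `Σ_k ι_k c_k π_k ∈ C(H)`),
  **`exists_algEquiv_pi_centralizer_of_hom_orthogonal`** (`C(H) ≃ₐ[ℚ] Π_k C(W_k)` — «with equality holding if
  `Hom(Aᵢ, Aⱼ) = 0`»), `exists_algEquiv_pi_centralizer_of_forall_stable`, `finrank_centralizer_eq_sum_of_hom_orthogonal`.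
* §3 (a polarization `ψ`) **`Polarization.coe_apply_centralizer_adjoint_eq`** (any block map over the restrictions carries `†` to
  `Π_k †_k` — «the involution it defines on `C(A)` is the restriction of the product of the involutions»),
  **`Polarization.exists_algEquiv_pi_centralizer_adjoint_of_hom_orthogonal`** (`(C(H), †) ≃ₐ Π_k (C(W_k), †_k)`).
* §4 (canonical blocks) **`Polarization.exists_algEquiv_pi_centralizer_minimal_stable_adjoint`** (`(C(H), †) ≃ₐ Π_i (C(S_i), †_i)`
  over the minimal `E_φ`-stable sub-Hodge structures `S_i`), `Polarization.finrank_centralizer_eq_finsum_minimal_stable`.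
-/

noncomputable section

namespace Literature.AlgebraicGeometry.Motives

namespace HodgeStructure

universe u

variable {V : Type u} [AddCommGroup V] [Module ℚ V] {n : ℤ} {H : HodgeStructure V n}

/-! ## §1 Every `c ∈ C(H)` preserves the blocks and restricts to `C(W_k)`; `C(H) ↪ Π_k C(W_k)` -/

section Blocks

variable {κ : Type*} [Fintype κ] [DecidableEq κ] (W : κ → SubHodgeStructure H)
  (hW : DirectSum.IsInternal fun k => (W k).toSubmodule)

include hW

omit [Fintype κ] in
/-- The projection `π_k : V → V` onto a block of an internal direct sum of sub-Hodge structures is a Hodge endomorphism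
(it underlies the morphism `SubHodgeStructure.internalProjHom`, Voisin Lemma 7.26). [cite: VoisinHodgeI2002, §7.3.1 Lemma 7.26]
[cite: Milne1999LefschetzClasses, §1 p. 643] -/
theorem isInternalProj_mem_endAlg' (k : κ) : isInternalProj hW k ∈ H.endAlg := by
  rw [← SubHodgeStructure.internalProjHom_toLinearMap W hW k]
  exact Hom.toLinearMap_mem_endAlg _

omit [Fintype κ] in
/-- **`c ∈ C(H)` maps every block `W_k` into itself**: `c` commutes with the Hodge endomorphism `π_k`, so
`c v = c (π_k v) = π_k (c v) ∈ W_k` («`C(A) ⊂ C(A₁) × ⋯ × C(A_s)`», block-diagonality). [cite: Milne1999LefschetzClasses, §1 p. 643]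
[cite: Moonen2004MT, §4 Lemma 4.6] -/
theorem apply_mem_of_mem_centralizer_endAlg {c : Module.End ℚ V}
    (hc : c ∈ Subalgebra.centralizer ℚ (H.endAlg : Set (Module.End ℚ V))) (k : κ) {v : V}
    (hv : v ∈ (W k).toSubmodule) : c v ∈ (W k).toSubmodule := by
  have h := (Subalgebra.mem_centralizer_iff ℚ).1 hc _ (isInternalProj_mem_endAlg' W hW k)
  have hv' : c v = isInternalProj hW k (c v) := by
    conv_lhs => rw [← isInternalProj_apply_of_mem hW hv]
    exact (LinearMap.congr_fun h v).symm
  rw [hv']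
  exact isInternalProj_apply_mem hW k _

omit [Fintype κ] in
/-- **The restriction `c|_{W_k}` of `c ∈ C(H)` lies in `C(W_k)`**: a Hodge endomorphism `b` of `W_k` extends by zero (along
`⊕_{l ≠ k} W_l`) to `a ∈ E_φ(H)` with `a|_{W_k} = b`, and `c a = a c` restricts to `c|_{W_k} b = b c|_{W_k}`.
[cite: Milne1999LefschetzClasses, §1 p. 643] [cite: Lange2023AbelianVarietiesComplex, §2.4.4 proof of Cor. 2.4.26 (p. 124)] -/
theorem restrict_mem_centralizer_endAlg {c : Module.End ℚ V}
    (hc : c ∈ Subalgebra.centralizer ℚ (H.endAlg : Set (Module.End ℚ V))) (k : κ) :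
    c.restrict (fun _ hv => apply_mem_of_mem_centralizer_endAlg W hW hc k hv) ∈
      Subalgebra.centralizer ℚ ((W k).toHodgeStructure.endAlg : Set (Module.End ℚ (W k).toSubmodule)) := by
  rw [Subalgebra.mem_centralizer_iff]
  intro b hb
  obtain ⟨a, ha, hab, -⟩ := (W k).exists_mem_endAlg_apply_eq_apply_eq_zero _
    (SubHodgeStructure.isCompl_iSup'_ne W hW k) hb
  have hca := (Subalgebra.mem_centralizer_iff ℚ).1 hc a ha
  refine LinearMap.ext fun v => Subtype.ext ?_
  change ((b (c.restrict _ v) : (W k).toSubmodule) : V) = c ((b v : (W k).toSubmodule) : V)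
  rw [← hab, ← hab, LinearMap.coe_restrict_apply]
  exact LinearMap.congr_fun hca (v : V)

/-- **«`C(A) ⊂ C(A₁) × ⋯ × C(A_s)`»: restriction to the blocks is an INJECTIVE homomorphism of `ℚ`-algebras
`r : C(H) →ₐ[ℚ] Π_k C(W_k)`, `(r c)_k v = c v`**, for every internal direct sum of sub-Hodge structures (injective because
`V = ⊕_k W_k` and `c` is determined by its restrictions). [cite: Milne1999LefschetzClasses, §1 p. 643] [cite: Moonen2004MT, §4 Lemma 4.6] -/
theorem exists_algHom_pi_centralizer :
    ∃ r : Subalgebra.centralizer ℚ (H.endAlg : Set (Module.End ℚ V)) →ₐ[ℚ]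
        Π k, Subalgebra.centralizer ℚ ((W k).toHodgeStructure.endAlg : Set (Module.End ℚ (W k).toSubmodule)),
      (∀ (c : Subalgebra.centralizer ℚ (H.endAlg : Set (Module.End ℚ V))) (k : κ) (v : (W k).toSubmodule),
        ((r c k : Module.End ℚ (W k).toSubmodule) v : V) = (c : Module.End ℚ V) v) ∧
      Function.Injective r := by
  let ρr : Subalgebra.centralizer ℚ (H.endAlg : Set (Module.End ℚ V)) →+*
      Π k, Subalgebra.centralizer ℚ ((W k).toHodgeStructure.endAlg : Set (Module.End ℚ (W k).toSubmodule)) :=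
    { toFun := fun c k => ⟨(c : Module.End ℚ V).restrict
          (fun _ hv => apply_mem_of_mem_centralizer_endAlg W hW c.2 k hv), restrict_mem_centralizer_endAlg W hW c.2 k⟩
      map_one' := by
        funext k
        exact Subtype.ext (LinearMap.ext fun v => Subtype.ext rfl)
      map_mul' := fun a b => by
        funext k
        exact Subtype.ext (LinearMap.ext fun v => Subtype.ext rfl)
      map_zero' := by
        funext k
        exact Subtype.ext (LinearMap.ext fun v => Subtype.ext rfl)
      map_add' := fun a b => by
        funext k
        exact Subtype.ext (LinearMap.ext fun v => Subtype.ext rfl) }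
  let r : Subalgebra.centralizer ℚ (H.endAlg : Set (Module.End ℚ V)) →ₐ[ℚ]
      Π k, Subalgebra.centralizer ℚ ((W k).toHodgeStructure.endAlg : Set (Module.End ℚ (W k).toSubmodule)) :=
    @RingHom.toRatAlgHom (Subalgebra.centralizer ℚ (H.endAlg : Set (Module.End ℚ V)))
      (Π k, Subalgebra.centralizer ℚ ((W k).toHodgeStructure.endAlg : Set (Module.End ℚ (W k).toSubmodule)))
      _ _ _ _ ρr
  have hr : ∀ (c : Subalgebra.centralizer ℚ (H.endAlg : Set (Module.End ℚ V))) (k : κ) (v : (W k).toSubmodule),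
      ((r c k : Module.End ℚ (W k).toSubmodule) v : V) = (c : Module.End ℚ V) v := fun _ _ _ => rfl
  refine ⟨r, hr, ?_⟩
  rw [injective_iff_map_eq_zero]
  intro c hc
  apply Subtype.ext
  refine LinearMap.ext fun v => ?_
  rw [← sum_isInternalProj_apply hW Finset.univ (fun j hj => absurd (Finset.mem_univ j) hj) v, map_sum]
  refine Finset.sum_eq_zero fun k _ => ?_
  have h1 : (c : Module.End ℚ V) (isInternalProj hW k v) =
      ((r c k : Module.End ℚ (W k).toSubmodule) ⟨isInternalProj hW k v, isInternalProj_apply_mem hW k v⟩ : V) := by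
    rw [hr]
  rw [h1, hc, Pi.zero_apply, ZeroMemClass.coe_zero, LinearMap.zero_apply, Submodule.coe_zero]

/-! ## §2 Hom-orthogonal blocks: `C(H) ≃ₐ[ℚ] Π_k C(W_k)` -/

omit [Fintype κ] in
/-- **`E_φ`-stable blocks are Hom-orthogonal**: if every `a ∈ E_φ` preserves every `W_k`, then `Hom_HS(W_k, W_l) = 0` for
`k ≠ l` (the Hodge endomorphism `ι_l ∘ f ∘ π_k` must preserve `W_k`, so `f(W_k) ⊆ W_k ∩ W_l = 0`; Milne's criterion).
[cite: Milne1999LefschetzClasses, §1 p. 643] [cite: Lange2023AbelianVarietiesComplex, §2.4.4 proof of Cor. 2.4.26 (p. 124)] -/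
theorem hom_eq_zero_of_forall_stable (hst : ∀ k, ∀ a ∈ H.endAlg, ∀ v ∈ (W k).toSubmodule, a v ∈ (W k).toSubmodule)
    {k l : κ} (hkl : k ≠ l) (f : Hom (W k).toHodgeStructure (W l).toHodgeStructure) : f = 0 := by
  -- the Hodge endomorphism `a = ι_l ∘ f ∘ π_k`
  let πH : Hom H (W k).toHodgeStructure :=
    (SubHodgeStructure.internalProjHom W hW k).codRestrict (W k) (SubHodgeStructure.internalProjHom_apply_mem W hW k)
  have ha : ((W l).subtypeHom.comp (f.comp πH)).toLinearMap ∈ H.endAlg := Hom.toLinearMap_mem_endAlg _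
  refine Hom.ext (LinearMap.ext fun x => Subtype.ext ?_)
  have hπx : πH.toLinearMap (x : V) = x := Subtype.ext (by
    change (SubHodgeStructure.internalProjHom W hW k).toLinearMap (x : V) = x
    rw [SubHodgeStructure.internalProjHom_toLinearMap]
    exact isInternalProj_apply_of_mem hW x.2)
  have hax : ((W l).subtypeHom.comp (f.comp πH)).toLinearMap (x : V) = ((f.toLinearMap x : (W l).toSubmodule) : V) := by
    rw [Hom.comp_toLinearMap, Hom.comp_toLinearMap, LinearMap.comp_apply, LinearMap.comp_apply, hπx]
    rfl
  -- `a x ∈ W_k ∩ W_l = 0`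
  have h1 : ((f.toLinearMap x : (W l).toSubmodule) : V) ∈ (W k).toSubmodule := by
    rw [← hax]
    exact hst k _ ha _ x.2
  have h2 : ((f.toLinearMap x : (W l).toSubmodule) : V) ∈ (W l).toSubmodule := (f.toLinearMap x).2
  have hd := (hW.submodule_iSupIndep.pairwiseDisjoint hkl).le_bot ⟨h1, h2⟩
  rw [Submodule.mem_bot] at hd
  rw [hd, Hom.zero_toLinearMap, LinearMap.zero_apply, Submodule.coe_zero]

/-- Evaluation of the glued map `Σ_k ι_k ∘ c_k ∘ π_k` on a vector of the block `W_l`. [cite: BourbakiAlgebre1a3, Ch. II §1 no. 8 Prop. 12] -/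
theorem sum_subtype_comp_comp_codRestrict_apply_of_mem (c : Π k, Module.End ℚ (W k).toSubmodule) {l : κ} {w : V}
    (hw : w ∈ (W l).toSubmodule) :
    (∑ k, (W k).toSubmodule.subtype ∘ₗ c k ∘ₗ
        (isInternalProj hW k).codRestrict (W k).toSubmodule (isInternalProj_apply_mem hW k)) w = ((c l ⟨w, hw⟩ : (W l).toSubmodule) : V) := by
  rw [LinearMap.sum_apply, Finset.sum_eq_single l (fun k _ hkl => ?_) (fun h => (h (Finset.mem_univ l)).elim)]
  · have hπ : (isInternalProj hW l).codRestrict (W l).toSubmodule (isInternalProj_apply_mem hW l) w = ⟨w, hw⟩ :=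
      Subtype.ext (isInternalProj_apply_of_mem hW hw)
    rw [LinearMap.comp_apply, LinearMap.comp_apply, hπ, Submodule.subtype_apply]
  · have h0 : (isInternalProj hW k).codRestrict (W k).toSubmodule (isInternalProj_apply_mem hW k) w = 0 :=
      Subtype.ext (isInternalProj_apply_of_mem_ne hW (Ne.symm hkl) hw)
    rw [LinearMap.comp_apply, LinearMap.comp_apply, h0, map_zero, map_zero]

variable (horth : ∀ k l, k ≠ l → ∀ f : Hom (W k).toHodgeStructure (W l).toHodgeStructure, f = 0)

include horth

/-- **Gluing: for Hom-orthogonal blocks, `Σ_k ι_k ∘ c_k ∘ π_k ∈ C(H)` whenever `c_k ∈ C(W_k)`** (a Hodge endomorphism `a`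
preserves each block — `apply_mem_of_hom_orthogonal` — and `a|_{W_k} ∈ E_φ(W_k)` commutes with `c_k`).
[cite: Milne1999LefschetzClasses, §1 p. 643 («with equality holding if and only if `Hom(Aᵢ, Aⱼ) = 0`»)] [cite: Moonen2004MT, §4 Lemma 4.6] -/
theorem sum_comp_mem_centralizer_endAlg_of_hom_orthogonal
    (c : Π k, Subalgebra.centralizer ℚ ((W k).toHodgeStructure.endAlg : Set (Module.End ℚ (W k).toSubmodule))) :
    ∑ k, (W k).toSubmodule.subtype ∘ₗ (c k : Module.End ℚ (W k).toSubmodule) ∘ₗ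
        (isInternalProj hW k).codRestrict (W k).toSubmodule (isInternalProj_apply_mem hW k) ∈
      Subalgebra.centralizer ℚ (H.endAlg : Set (Module.End ℚ V)) := by
  rw [Subalgebra.mem_centralizer_iff]
  intro a ha
  have hmem : ∀ k, ∀ v ∈ (W k).toSubmodule, a v ∈ (W k).toSubmodule :=
    fun k v hv => apply_mem_of_hom_orthogonal W hW horth ha k hv
  -- `a|_{W_k} ∈ E_φ(W_k)` commutes with `c_k`
  have hcomm : ∀ k, a.restrict (hmem k) * (c k : Module.End ℚ (W k).toSubmodule) =
      (c k : Module.End ℚ (W k).toSubmodule) * a.restrict (hmem k) := fun k =>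
    (Subalgebra.mem_centralizer_iff ℚ).1 (c k).2 _ (restrict_mem_endAlg_of_mem_endAlg (W k) ha (hmem k))
  -- compare both sides on `v = Σ_l π_l v`; it suffices to treat `v ∈ W_l`
  refine LinearMap.ext fun v => ?_
  rw [← sum_isInternalProj_apply hW Finset.univ (fun j hj => absurd (Finset.mem_univ j) hj) v, map_sum, map_sum]
  refine Finset.sum_congr rfl fun l _ => ?_
  have hvl : isInternalProj hW l v ∈ (W l).toSubmodule := isInternalProj_apply_mem hW l v
  -- both sides, evaluated on a vector of `W_l`, reduce to the `l`-th summand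
  rw [Module.End.mul_apply, Module.End.mul_apply,
    sum_subtype_comp_comp_codRestrict_apply_of_mem W hW (fun k => (c k : Module.End ℚ (W k).toSubmodule)) hvl,
    sum_subtype_comp_comp_codRestrict_apply_of_mem W hW (fun k => (c k : Module.End ℚ (W k).toSubmodule))
      (hmem l _ hvl)]
  have h := congrArg Subtype.val (LinearMap.congr_fun (hcomm l) ⟨isInternalProj hW l v, hvl⟩)
  simp only [Module.End.mul_apply, LinearMap.restrict_apply] at h
  exact h

/-- **«with equality holding if `Hom(Aᵢ, Aⱼ) = 0`»: for Hom-orthogonal blocks restriction is an isomorphism of `ℚ`-algebras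
`C(H) ≃ₐ[ℚ] Π_k C(W_k)`, `(e c)_k v = c v`** (injective by §1; surjective by gluing).
[cite: Milne1999LefschetzClasses, §1 p. 643 and Prop. 1.1] [cite: Moonen2004MT, §4 Lemma 4.6] -/
theorem exists_algEquiv_pi_centralizer_of_hom_orthogonal :
    ∃ e : Subalgebra.centralizer ℚ (H.endAlg : Set (Module.End ℚ V)) ≃ₐ[ℚ]
        Π k, Subalgebra.centralizer ℚ ((W k).toHodgeStructure.endAlg : Set (Module.End ℚ (W k).toSubmodule)),
      ∀ (c : Subalgebra.centralizer ℚ (H.endAlg : Set (Module.End ℚ V))) (k : κ) (v : (W k).toSubmodule),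
        ((e c k : Module.End ℚ (W k).toSubmodule) v : V) = (c : Module.End ℚ V) v := by
  obtain ⟨r, hr, hinj⟩ := exists_algHom_pi_centralizer W hW
  have hsurj : Function.Surjective r := by
    intro c
    refine ⟨⟨_, sum_comp_mem_centralizer_endAlg_of_hom_orthogonal W hW horth c⟩,
      funext fun k => Subtype.ext (LinearMap.ext fun v => Subtype.ext ?_)⟩
    rw [hr]
    exact sum_subtype_comp_comp_codRestrict_apply_of_mem W hW (fun l => (c l : Module.End ℚ (W l).toSubmodule)) v.2
  exact ⟨AlgEquiv.ofBijective r ⟨hinj, hsurj⟩, hr⟩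

omit horth in
/-- **`C(H) ≃ₐ[ℚ] Π_k C(W_k)` along an internal direct sum into `E_φ`-STABLE sub-Hodge structures** (stable blocks are
Hom-orthogonal). [cite: Milne1999LefschetzClasses, §1 p. 643 and Prop. 1.1] -/
theorem exists_algEquiv_pi_centralizer_of_forall_stable
    (hst : ∀ k, ∀ a ∈ H.endAlg, ∀ v ∈ (W k).toSubmodule, a v ∈ (W k).toSubmodule) :
    ∃ e : Subalgebra.centralizer ℚ (H.endAlg : Set (Module.End ℚ V)) ≃ₐ[ℚ]
        Π k, Subalgebra.centralizer ℚ ((W k).toHodgeStructure.endAlg : Set (Module.End ℚ (W k).toSubmodule)),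
      ∀ (c : Subalgebra.centralizer ℚ (H.endAlg : Set (Module.End ℚ V))) (k : κ) (v : (W k).toSubmodule),
        ((e c k : Module.End ℚ (W k).toSubmodule) v : V) = (c : Module.End ℚ V) v :=
  exists_algEquiv_pi_centralizer_of_hom_orthogonal W hW fun _ _ hkl f => hom_eq_zero_of_forall_stable W hW hst hkl f

/-- **`dim_ℚ C(H) = Σ_k dim_ℚ C(W_k)`** for Hom-orthogonal blocks. [cite: Milne1999LefschetzClasses, §1 p. 643 and Prop. 1.1] -/
theorem finrank_centralizer_eq_sum_of_hom_orthogonal [Module.Finite ℚ V] :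
    Module.finrank ℚ (Subalgebra.centralizer ℚ (H.endAlg : Set (Module.End ℚ V))) =
      ∑ k, Module.finrank ℚ
        (Subalgebra.centralizer ℚ ((W k).toHodgeStructure.endAlg : Set (Module.End ℚ (W k).toSubmodule))) := by
  obtain ⟨e, -⟩ := exists_algEquiv_pi_centralizer_of_hom_orthogonal W hW horth
  haveI : ∀ k, Module.Free ℚ
      (Subalgebra.centralizer ℚ ((W k).toHodgeStructure.endAlg : Set (Module.End ℚ (W k).toSubmodule))) := fun k => by
    exact Module.Free.of_divisionRing ℚ
      (Subalgebra.centralizer ℚ ((W k).toHodgeStructure.endAlg : Set (Module.End ℚ (W k).toSubmodule)))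
  rw [LinearEquiv.finrank_eq e.toLinearEquiv, Module.finrank_pi_fintype]

/-! ## §3 The involution: any block map over the restrictions carries `†` to `Π_k †_k` -/

omit [Fintype κ] [DecidableEq κ] hW horth in
/-- **«the involution it defines on `C(A)` is the restriction of the product of the involutions»**: for a polarization `ψ`,
`c ∈ C(H)`, and ANY map `e : C(H) → Π_k C(W_k)` lying over the restrictions (`(e c)_k v = c v`), `(e c†)_k = (e c)_k^{†_k}`
where `†` is the adjoint for `ψ` (which preserves `C(H)`, p34 g18-#1) and `†_k` the adjoint for `ψ|_{W_k}` (adjoints of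
restrictions, g51-#1). [cite: Milne1999LefschetzClasses, §1 p. 643 and Prop. 1.1] [cite: Huybrechts2016K3, §3.3.5 eq. (3.3)] -/
theorem Polarization.coe_apply_centralizer_adjoint_eq [Module.Finite ℚ V] (ψ : Polarization H)
    (e : Subalgebra.centralizer ℚ (H.endAlg : Set (Module.End ℚ V)) →
      Π k, Subalgebra.centralizer ℚ ((W k).toHodgeStructure.endAlg : Set (Module.End ℚ (W k).toSubmodule)))
    (he : ∀ (c : Subalgebra.centralizer ℚ (H.endAlg : Set (Module.End ℚ V))) (k : κ) (v : (W k).toSubmodule),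
      ((e c k : Module.End ℚ (W k).toSubmodule) v : V) = (c : Module.End ℚ V) v)
    (c : Subalgebra.centralizer ℚ (H.endAlg : Set (Module.End ℚ V))) (k : κ) :
    ((e ⟨ψ.adjoint c, ψ.adjoint_mem_centralizer_endAlg c.2⟩ k) : Module.End ℚ (W k).toSubmodule) =
      (ψ.restrict (W k)).adjoint (e c k) :=
  (ψ.restrict_adjoint_eq_of_forall_coe_apply_eq (W k) (fun x => he c k x) fun y => he _ k y).symm

/-- **MILNE'S PROP. 1.1 FOR THE CENTRALIZER, internal form: `(C(H), †) ≃ₐ Π_k (C(W_k), †_k)` along a Hom-orthogonal internal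
direct sum of sub-Hodge structures of a polarized `ℚ`-Hodge structure** — an isomorphism of `ℚ`-algebras with involution.
[cite: Milne1999LefschetzClasses, §1 p. 643 and Prop. 1.1] [cite: Moonen2004MT, §4 Lemma 4.6] -/
theorem Polarization.exists_algEquiv_pi_centralizer_adjoint_of_hom_orthogonal [Module.Finite ℚ V] (ψ : Polarization H) :
    ∃ e : Subalgebra.centralizer ℚ (H.endAlg : Set (Module.End ℚ V)) ≃ₐ[ℚ]
        Π k, Subalgebra.centralizer ℚ ((W k).toHodgeStructure.endAlg : Set (Module.End ℚ (W k).toSubmodule)),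
      (∀ (c : Subalgebra.centralizer ℚ (H.endAlg : Set (Module.End ℚ V))) (k : κ) (v : (W k).toSubmodule),
        ((e c k : Module.End ℚ (W k).toSubmodule) v : V) = (c : Module.End ℚ V) v) ∧
      ∀ (c : Subalgebra.centralizer ℚ (H.endAlg : Set (Module.End ℚ V))) (k : κ),
        ((e ⟨ψ.adjoint c, ψ.adjoint_mem_centralizer_endAlg c.2⟩ k) : Module.End ℚ (W k).toSubmodule) =
          (ψ.restrict (W k)).adjoint (e c k) := by
  obtain ⟨e, he⟩ := exists_algEquiv_pi_centralizer_of_hom_orthogonal W hW horth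
  exact ⟨e, he, fun c k => ψ.coe_apply_centralizer_adjoint_eq W e he c k⟩

end Blocks

/-! ## §4 The canonical blocks: `(C(H), †) ≃ₐ Π_i (C(S_i), †_i)` over the minimal `E_φ`-stable sub-Hodge structures -/

section Canonical

variable [Module.Finite ℚ V]

open Classical in
/-- **`(C(H), †) ≃ₐ Π_i (C(S_i), †_i)` OVER THE CANONICAL BLOCKS** — Milne's Prop. 1.1 for the centralizer, intrinsically: along the
decomposition `V = ⊕_i S_i` of a polarized `ℚ`-Hodge structure into its minimal `E_φ`-stable sub-Hodge structures (g51-#8; the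
blocks are Hom-orthogonal, g51-#9) restriction is an isomorphism of `ℚ`-algebras with involution from Milne's centralizer
`C(H) = End_{E_φ}(V)` onto the product of the centralizers `C(S_i) = End_{E_φ(S_i)}(S_i)`.
[cite: Milne1999LefschetzClasses, §1 p. 643 and Prop. 1.1] [cite: Lange2023AbelianVarietiesComplex, §2.4.4 Cor. 2.4.26 (p. 124)] -/
theorem Polarization.exists_algEquiv_pi_centralizer_minimal_stable_adjoint (ψ : Polarization H) :
    ∃ e : Subalgebra.centralizer ℚ (H.endAlg : Set (Module.End ℚ V)) ≃ₐ[ℚ]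
        Π S : {S : SubHodgeStructure H // (∀ a ∈ H.endAlg, ∀ v ∈ S.toSubmodule, a v ∈ S.toSubmodule) ∧ S.toSubmodule ≠ ⊥ ∧
      ∀ S' : SubHodgeStructure H, (∀ a ∈ H.endAlg, ∀ v ∈ S'.toSubmodule, a v ∈ S'.toSubmodule) →
        S'.toSubmodule ≤ S.toSubmodule → S'.toSubmodule = ⊥ ∨ S'.toSubmodule = S.toSubmodule},
          Subalgebra.centralizer ℚ (((S : SubHodgeStructure H)).toHodgeStructure.endAlg :
            Set (Module.End ℚ (S : SubHodgeStructure H).toSubmodule)),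
      (∀ (c : Subalgebra.centralizer ℚ (H.endAlg : Set (Module.End ℚ V))) (S : {S : SubHodgeStructure H // (∀ a ∈ H.endAlg, ∀ v ∈ S.toSubmodule, a v ∈ S.toSubmodule) ∧ S.toSubmodule ≠ ⊥ ∧
      ∀ S' : SubHodgeStructure H, (∀ a ∈ H.endAlg, ∀ v ∈ S'.toSubmodule, a v ∈ S'.toSubmodule) →
        S'.toSubmodule ≤ S.toSubmodule → S'.toSubmodule = ⊥ ∨ S'.toSubmodule = S.toSubmodule})
          (v : (S : SubHodgeStructure H).toSubmodule),
        ((e c S : Module.End ℚ (S : SubHodgeStructure H).toSubmodule) v : V) = (c : Module.End ℚ V) v) ∧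
      ∀ (c : Subalgebra.centralizer ℚ (H.endAlg : Set (Module.End ℚ V))) (S : {S : SubHodgeStructure H // (∀ a ∈ H.endAlg, ∀ v ∈ S.toSubmodule, a v ∈ S.toSubmodule) ∧ S.toSubmodule ≠ ⊥ ∧
      ∀ S' : SubHodgeStructure H, (∀ a ∈ H.endAlg, ∀ v ∈ S'.toSubmodule, a v ∈ S'.toSubmodule) →
        S'.toSubmodule ≤ S.toSubmodule → S'.toSubmodule = ⊥ ∨ S'.toSubmodule = S.toSubmodule}),
        ((e ⟨ψ.adjoint c, ψ.adjoint_mem_centralizer_endAlg c.2⟩ S) :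
            Module.End ℚ (S : SubHodgeStructure H).toSubmodule) =
          (ψ.restrict (S : SubHodgeStructure H)).adjoint (e c S) := by
  haveI : Fintype {S : SubHodgeStructure H // (∀ a ∈ H.endAlg, ∀ v ∈ S.toSubmodule, a v ∈ S.toSubmodule) ∧ S.toSubmodule ≠ ⊥ ∧
      ∀ S' : SubHodgeStructure H, (∀ a ∈ H.endAlg, ∀ v ∈ S'.toSubmodule, a v ∈ S'.toSubmodule) →
        S'.toSubmodule ≤ S.toSubmodule → S'.toSubmodule = ⊥ ∨ S'.toSubmodule = S.toSubmodule} :=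
    ψ.finite_setOf_minimal_stable.fintype
  exact ψ.exists_algEquiv_pi_centralizer_adjoint_of_hom_orthogonal
    (Subtype.val : {S : SubHodgeStructure H // (∀ a ∈ H.endAlg, ∀ v ∈ S.toSubmodule, a v ∈ S.toSubmodule) ∧ S.toSubmodule ≠ ⊥ ∧
      ∀ S' : SubHodgeStructure H, (∀ a ∈ H.endAlg, ∀ v ∈ S'.toSubmodule, a v ∈ S'.toSubmodule) →
        S'.toSubmodule ≤ S.toSubmodule → S'.toSubmodule = ⊥ ∨ S'.toSubmodule = S.toSubmodule} → SubHodgeStructure H)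
    ψ.isInternal_minimal_stable
    fun S S' hne f => ψ.hom_eq_zero_of_minimal_stable_of_ne S.2 S'.2 (fun h => hne (Subtype.ext h)) f

open Classical in
/-- **`dim_ℚ C(H) = Σ_i dim_ℚ C(S_i)`** over the canonical blocks. [cite: Milne1999LefschetzClasses, §1 p. 643 and Prop. 1.1] -/
theorem Polarization.finrank_centralizer_eq_finsum_minimal_stable (ψ : Polarization H) :
    Module.finrank ℚ (Subalgebra.centralizer ℚ (H.endAlg : Set (Module.End ℚ V))) =
      ∑ᶠ S : {S : SubHodgeStructure H // (∀ a ∈ H.endAlg, ∀ v ∈ S.toSubmodule, a v ∈ S.toSubmodule) ∧ S.toSubmodule ≠ ⊥ ∧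
      ∀ S' : SubHodgeStructure H, (∀ a ∈ H.endAlg, ∀ v ∈ S'.toSubmodule, a v ∈ S'.toSubmodule) →
        S'.toSubmodule ≤ S.toSubmodule → S'.toSubmodule = ⊥ ∨ S'.toSubmodule = S.toSubmodule},
        Module.finrank ℚ (Subalgebra.centralizer ℚ (((S : SubHodgeStructure H)).toHodgeStructure.endAlg :
          Set (Module.End ℚ (S : SubHodgeStructure H).toSubmodule))) := by
  haveI : Fintype {S : SubHodgeStructure H // (∀ a ∈ H.endAlg, ∀ v ∈ S.toSubmodule, a v ∈ S.toSubmodule) ∧ S.toSubmodule ≠ ⊥ ∧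
      ∀ S' : SubHodgeStructure H, (∀ a ∈ H.endAlg, ∀ v ∈ S'.toSubmodule, a v ∈ S'.toSubmodule) →
        S'.toSubmodule ≤ S.toSubmodule → S'.toSubmodule = ⊥ ∨ S'.toSubmodule = S.toSubmodule} :=
    ψ.finite_setOf_minimal_stable.fintype
  rw [finrank_centralizer_eq_sum_of_hom_orthogonal
      (Subtype.val : {S : SubHodgeStructure H // (∀ a ∈ H.endAlg, ∀ v ∈ S.toSubmodule, a v ∈ S.toSubmodule) ∧ S.toSubmodule ≠ ⊥ ∧
        ∀ S' : SubHodgeStructure H, (∀ a ∈ H.endAlg, ∀ v ∈ S'.toSubmodule, a v ∈ S'.toSubmodule) →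
          S'.toSubmodule ≤ S.toSubmodule → S'.toSubmodule = ⊥ ∨ S'.toSubmodule = S.toSubmodule} → SubHodgeStructure H)
      ψ.isInternal_minimal_stable
      (fun S S' hne f => ψ.hom_eq_zero_of_minimal_stable_of_ne S.2 S'.2 (fun h => hne (Subtype.ext h)) f),
    finsum_eq_sum_of_fintype]

end Canonical

end HodgeStructure

end Literature.AlgebraicGeometry.Motives
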